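import Literature.Computability.Complexity.StackPrograms
import Literature.Computability.Complexity.StringSwap
import Literature.Computability.Complexity.PairProjections
import Literature.Computability.Complexity.TautCertificates
import Mathlib.Data.List.DropRight
import HarnessLib

/-!
# Binary subtraction `⟨bin n, bin k⟩ ↦ bin (n - k)` is polynomial time (a stack program; trunk CplxCore)

The first program library written for the structured stack programs `Com` of `StackPrograms.lean`
(`Com.mem_FP`: a program with a polynomial cost bound computes an `FP` function). We program and
verify truncated binary subtraction on Mathlib's little-endian binary numerals `encodeNat`
(`Computability.encodeNat`, no zero bits at the most significant end), packaged for the pairing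
`boolPair`:

* `subPairFn ∈ FP` (`subPairFn_mem_FP`) with
  `subPairFn (boolPair (encodeNat n) (encodeNat k)) = encodeNat (n - k)` for `k ≤ n`
  (`subPairFn_encodeNat`);
* `reindexFn ∈ FP` (`reindexFn_mem_FP`) with
  `reindexFn (boolPair (encodeNat n) (encodeNat k)) = boolPair (encodeNat n) (encodeNat (n - k))`
  for `k ≤ n` (`reindexFn_encodeNat`) — the reindexing `(n, k) ↦ (n, n - k)` of doubly indexed
  integer sequences in binary (Bürgisser 2009, proof of Thm. 1.1(2): the coefficient of `X^k` in
  `∏_{i ≤ n} (X - i)` is `± σ_{n-k}(1, …, n)`), obtained from `subPairFn` with `copyFn`, `mapSndFn`,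
  `mapFstFn`.

The program `subProg` (registers `Rg`): parse the pair (two input bits per round; the separator
`01` switches to draining the second component), un-reverse both components, subtract bit by bit
with a borrow flag register, and emit the result most-significant-bit first while stripping the
leading zeros (which makes the output the canonical numeral). Its semantics is specified by total
functions (`parseSpec`, `subSpec`, `outSpec`) with exact register files (`Rg.mk`) and linear cost
bounds (`Runs` lemmas), for every input (malformed inputs give junk within the same budget).
Arithmetic, stated with the tree's value function `bitsToNat` (`BoolEncodings.lean`,
`bitsToNat_encodeNat`) and canonicity predicate `IsCanonicalNum` (`TautCertificates.lean`, the range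
of `encodeNat`, `isCanonicalNum_iff`): `encodeNat_bitsToNat` (canonical numerals are determined by
their value), `subBits` (schoolbook subtraction) and `bitsToNat_subBits`, `stripMSB = List.rdropWhile
(! ·)` (Mathlib) and `stripMSB_subBits`.

## References

* S. Arora, B. Barak, *Computational Complexity: A Modern Approach*, CUP 2009, §1.3 (polynomial
  time is robust; arithmetic on binary numerals), Thm. 2.8.
* T. Nipkow, G. Klein, *Concrete Semantics*, Springer 2014, Ch. 7–8 (big-step reasoning about
  WHILE-programs), for the verification style.
* P. Bürgisser, *On defining integers and proving arithmetic circuit lower bounds*, Comput.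
  Complexity 18 (2009) = ECCC TR06-113, proof of Thm. 1.1(2) (the reindexing served).
-/

namespace Literature.Computability.Complexity

open _root_.Computability

/-! ### Little-endian bit strings: value (`bitsToNat`), canonical form (`IsCanonicalNum`) -/

/-- Appending zero bits at the most significant end does not change the value. [folklore] -/
theorem bitsToNat_append_replicate_false (l : List Bool) (j : ℕ) :
    bitsToNat (l ++ List.replicate j false) = bitsToNat l := by
  simp [bitsToNat_append]

/-- `bitsToNat (l ++ [true]) = bitsToNat l + 2 ^ |l|`. [folklore] -/
theorem bitsToNat_append_true (l : List Bool) : bitsToNat (l ++ [true]) = bitsToNat l + 2 ^ l.length := by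
  simp [bitsToNat_append]

/-- A string ending in `true` is a canonical numeral. [folklore] -/
theorem isCanonicalNum_append_true (l : List Bool) : IsCanonicalNum (l ++ [true]) :=
  Or.inr (by simp)

/-- **Canonical numerals are determined by their value**: `encodeNat (bitsToNat w) = w` for `w` a
canonical numeral (`IsCanonicalNum w`: empty or ending in `true`, i.e. `w ∈ range encodeNat`,
`isCanonicalNum_iff`). [folklore] -/
theorem encodeNat_bitsToNat {w : List Bool} (hw : IsCanonicalNum w) : encodeNat (bitsToNat w) = w := by
  obtain ⟨n, rfl⟩ := (isCanonicalNum_iff w).1 hw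
  rw [bitsToNat_encodeNat]

/-- Parity is the first bit: `(encodeNat m).head? = some true ↔ m` is odd (serves the sign
`(-1)^{n-k}` test of `PochhammerWilkinsonDefinable.lean`). [folklore] -/
theorem head?_encodeNat_eq_some_true_iff (m : ℕ) : (encodeNat m).head? = some true ↔ m % 2 = 1 := by
  have hv := bitsToNat_encodeNat m
  rcases h : encodeNat m with _ | ⟨b, l⟩
  · rw [h, bitsToNat_nil] at hv
    subst hv
    simp
  · rw [h, bitsToNat_cons] at hv
    rw [List.head?_cons, Option.some.injEq]
    cases b
    · rw [Bool.toNat_false] at hv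
      simp only [Bool.false_eq_true, false_iff]
      omega
    · rw [Bool.toNat_true] at hv
      simp only [true_iff]
      omega

/-! ### Schoolbook subtraction on little-endian bit strings -/

/-- The result bit `a - c - br (mod 2)`. [folklore] -/
def subBit (a c br : Bool) : Bool := xor a (xor c br)

/-- The outgoing borrow of `a - c - br`. [folklore] -/
def subBorrow (a c br : Bool) : Bool := decide (a.toNat < c.toNat + br.toNat)

/-- The bit identity of one subtraction step. [folklore] -/
theorem subBit_add (a c br : Bool) :
    (subBit a c br).toNat + c.toNat + br.toNat = a.toNat + 2 * (subBorrow a c br).toNat := by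
  cases a <;> cases c <;> cases br <;> rfl

/-- Truncated schoolbook subtraction `u - v - br` on `|u|` bits (little-endian; missing bits of `v`
read as `0`): the list of result bits. [folklore] -/
def subBits : List Bool → List Bool → Bool → List Bool
  | [], _, _ => []
  | a :: u, v, br => subBit a (v.headD false) br :: subBits u v.tail (subBorrow a (v.headD false) br)

/-- `subBits` keeps the length of the first argument. [folklore] -/
@[simp] theorem length_subBits : ∀ (u v : List Bool) (br : Bool), (subBits u v br).length = u.length
  | [], _, _ => rfl
  | a :: u, v, br => by simp [subBits, length_subBits u]

/-- `bitsToNat` of a list through its head and tail defaults. [folklore] -/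
theorem bitsToNat_eq_headD_tail (v : List Bool) :
    bitsToNat v = (v.headD false).toNat + 2 * bitsToNat v.tail := by
  cases v <;> simp

/-- **Correctness of schoolbook subtraction**: if `bitsToNat v + br ≤ bitsToNat u` then
`bitsToNat (subBits u v br) + bitsToNat v + br = bitsToNat u`. [folklore] -/
theorem bitsToNat_subBits : ∀ (u v : List Bool) (br : Bool), bitsToNat v + br.toNat ≤ bitsToNat u →
    bitsToNat (subBits u v br) + bitsToNat v + br.toNat = bitsToNat u
  | [], v, br, h => by
    have h0 : bitsToNat [] = 0 := rfl
    have h1 : subBits [] v br = [] := rfl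
    rw [h1]
    omega
  | a :: u, v, br, h => by
    have hv := bitsToNat_eq_headD_tail v
    have hstep := subBit_add a (v.headD false) br
    have hsb : subBits (a :: u) v br =
        subBit a (v.headD false) br :: subBits u v.tail (subBorrow a (v.headD false) br) := rfl
    have hau : bitsToNat (a :: u) = a.toNat + 2 * bitsToNat u := rfl
    have hb1 := Bool.toNat_le (subBorrow a (v.headD false) br)
    have hb2 := Bool.toNat_le (subBit a (v.headD false) br)
    have hb3 := Bool.toNat_le (v.headD false)
    have hb4 := Bool.toNat_le a
    have hb5 := Bool.toNat_le br
    rw [hsb, bitsToNat_cons]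
    have hle : bitsToNat v.tail + (subBorrow a (v.headD false) br).toNat ≤ bitsToNat u := by
      omega
    have ih := bitsToNat_subBits u v.tail (subBorrow a (v.headD false) br) hle
    omega

/-- Dropping the leading `false`s of a bit string: `List.dropWhile (! ·)`. [folklore] -/
def dropFalses (r : List Bool) : List Bool := r.dropWhile (fun b => !b)

/-- `dropFalses [] = []`. [folklore] -/
@[simp] theorem dropFalses_nil : dropFalses [] = [] := rfl

/-- A leading `false` is dropped. [folklore] -/
@[simp] theorem dropFalses_cons_false (r : List Bool) : dropFalses (false :: r) = dropFalses r := rfl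

/-- At a leading `true` the dropping stops. [folklore] -/
@[simp] theorem dropFalses_cons_true (r : List Bool) : dropFalses (true :: r) = true :: r := rfl

/-- `r = 0^j ++ dropFalses r`. [folklore] -/
theorem replicate_append_dropFalses : ∀ r : List Bool, ∃ j, r = List.replicate j false ++ dropFalses r
  | [] => ⟨0, rfl⟩
  | true :: r => ⟨0, rfl⟩
  | false :: r => by
    obtain ⟨j, hj⟩ := replicate_append_dropFalses r
    refine ⟨j + 1, ?_⟩
    change false :: r = false :: (List.replicate j false ++ dropFalses r)
    rw [← hj]

/-- `dropFalses r` is empty or starts with `true`. [folklore] -/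
theorem dropFalses_nil_or_cons_true : ∀ r : List Bool, dropFalses r = [] ∨ ∃ r', dropFalses r = true :: r'
  | [] => Or.inl rfl
  | true :: r => Or.inr ⟨r, rfl⟩
  | false :: r => dropFalses_nil_or_cons_true r

/-- Stripping the zero bits at the most significant end of a little-endian bit string: Mathlib's
`List.rdropWhile (! ·)` (so `rdropWhile_prefix`, `rdropWhile_last_not`, `rdropWhile_eq_self_iff`, …
apply), definitionally `(dropFalses w.reverse).reverse` (`stripMSB_eq`). [folklore] -/
def stripMSB (w : List Bool) : List Bool := w.rdropWhile (fun b => !b)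

/-- `stripMSB w = (dropFalses w.reverse).reverse`. [folklore] -/
theorem stripMSB_eq (w : List Bool) : stripMSB w = (dropFalses w.reverse).reverse := rfl

/-- `w = stripMSB w ++ 0^j`. [folklore] -/
theorem stripMSB_append_replicate (w : List Bool) : ∃ j, w = stripMSB w ++ List.replicate j false := by
  obtain ⟨j, hj⟩ := replicate_append_dropFalses w.reverse
  refine ⟨j, ?_⟩
  have := congrArg List.reverse hj
  rw [List.reverse_reverse, List.reverse_append, List.reverse_replicate] at this
  exact this

/-- `stripMSB w` is a canonical numeral. [folklore] -/
theorem isCanonicalNum_stripMSB (w : List Bool) : IsCanonicalNum (stripMSB w) := by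
  rw [stripMSB_eq]
  rcases dropFalses_nil_or_cons_true w.reverse with h | ⟨r', h⟩
  · exact Or.inl (by rw [h]; rfl)
  · rw [h, List.reverse_cons]
    exact isCanonicalNum_append_true _

/-- `stripMSB` preserves the value. [folklore] -/
theorem bitsToNat_stripMSB (w : List Bool) : bitsToNat (stripMSB w) = bitsToNat w := by
  obtain ⟨j, hj⟩ := stripMSB_append_replicate w
  conv_rhs => rw [hj]
  rw [bitsToNat_append_replicate_false]

/-- **The canonical numeral of a difference**: for `bitsToNat v ≤ bitsToNat u`,
`stripMSB (subBits u v false) = encodeNat (bitsToNat u - bitsToNat v)`. [folklore] -/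
theorem stripMSB_subBits (u v : List Bool) (h : bitsToNat v ≤ bitsToNat u) :
    stripMSB (subBits u v false) = encodeNat (bitsToNat u - bitsToNat v) := by
  have hval := bitsToNat_subBits u v false (by simpa using h)
  simp only [Bool.toNat_false, add_zero] at hval
  rw [← encodeNat_bitsToNat (isCanonicalNum_stripMSB (subBits u v false)), bitsToNat_stripMSB]
  congr 1
  omega

/-! ### The stack program -/

namespace BinSub

/-- Registers of the subtraction program: input, the two parsed components (reversed), their
un-reversed copies, the borrow flag, the result (most significant bit first) and the output. [folklore] -/
inductive Rg
  | inp | u | v | u2 | v2 | br | res | out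
  deriving DecidableEq, Fintype

open Com

/-- Explicit register files. [folklore] -/
def mk (zinp zu zv zu2 zv2 zbr zres zout : List Bool) : Regs Rg := fun r =>
  match r with
  | .inp => zinp | .u => zu | .v => zv | .u2 => zu2 | .v2 => zv2 | .br => zbr | .res => zres | .out => zout

section MkLemmas

variable (zinp zu zv zu2 zv2 zbr zres zout x : List Bool)

/-- Reading register `inp` of an explicit file. [folklore] -/
@[simp] theorem mk_inp : mk zinp zu zv zu2 zv2 zbr zres zout .inp = zinp := rfl
/-- Reading register `u` of an explicit file. [folklore] -/
@[simp] theorem mk_u : mk zinp zu zv zu2 zv2 zbr zres zout .u = zu := rfl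
/-- Reading register `v` of an explicit file. [folklore] -/
@[simp] theorem mk_v : mk zinp zu zv zu2 zv2 zbr zres zout .v = zv := rfl
/-- Reading register `u2` of an explicit file. [folklore] -/
@[simp] theorem mk_u2 : mk zinp zu zv zu2 zv2 zbr zres zout .u2 = zu2 := rfl
/-- Reading register `v2` of an explicit file. [folklore] -/
@[simp] theorem mk_v2 : mk zinp zu zv zu2 zv2 zbr zres zout .v2 = zv2 := rfl
/-- Reading register `br` of an explicit file. [folklore] -/
@[simp] theorem mk_br : mk zinp zu zv zu2 zv2 zbr zres zout .br = zbr := rfl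
/-- Reading register `res` of an explicit file. [folklore] -/
@[simp] theorem mk_res : mk zinp zu zv zu2 zv2 zbr zres zout .res = zres := rfl
/-- Reading register `out` of an explicit file. [folklore] -/
@[simp] theorem mk_out : mk zinp zu zv zu2 zv2 zbr zres zout .out = zout := rfl

/-- Updating register `inp` of an explicit file. [folklore] -/
@[simp] theorem update_inp : Function.update (mk zinp zu zv zu2 zv2 zbr zres zout) .inp x =
    mk x zu zv zu2 zv2 zbr zres zout := by
  funext r; cases r <;> simp
/-- Updating register `u` of an explicit file. [folklore] -/
@[simp] theorem update_u : Function.update (mk zinp zu zv zu2 zv2 zbr zres zout) .u x =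
    mk zinp x zv zu2 zv2 zbr zres zout := by
  funext r; cases r <;> simp
/-- Updating register `v` of an explicit file. [folklore] -/
@[simp] theorem update_v : Function.update (mk zinp zu zv zu2 zv2 zbr zres zout) .v x =
    mk zinp zu x zu2 zv2 zbr zres zout := by
  funext r; cases r <;> simp
/-- Updating register `u2` of an explicit file. [folklore] -/
@[simp] theorem update_u2 : Function.update (mk zinp zu zv zu2 zv2 zbr zres zout) .u2 x =
    mk zinp zu zv x zv2 zbr zres zout := by
  funext r; cases r <;> simp
/-- Updating register `v2` of an explicit file. [folklore] -/
@[simp] theorem update_v2 : Function.update (mk zinp zu zv zu2 zv2 zbr zres zout) .v2 x =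
    mk zinp zu zv zu2 x zbr zres zout := by
  funext r; cases r <;> simp
/-- Updating register `br` of an explicit file. [folklore] -/
@[simp] theorem update_br : Function.update (mk zinp zu zv zu2 zv2 zbr zres zout) .br x =
    mk zinp zu zv zu2 zv2 x zres zout := by
  funext r; cases r <;> simp
/-- Updating register `res` of an explicit file. [folklore] -/
@[simp] theorem update_res : Function.update (mk zinp zu zv zu2 zv2 zbr zres zout) .res x =
    mk zinp zu zv zu2 zv2 zbr x zout := by
  funext r; cases r <;> simp
/-- Updating register `out` of an explicit file. [folklore] -/
@[simp] theorem update_out : Function.update (mk zinp zu zv zu2 zv2 zbr zres zout) .out x =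
    mk zinp zu zv zu2 zv2 zbr zres x := by
  funext r; cases r <;> simp

end MkLemmas

/-- The initial register file is `mk z [] … []`. [folklore] -/
theorem init_eq (z : List Bool) : Regs.init Rg.inp z = mk z [] [] [] [] [] [] [] := by
  funext r; cases r <;> simp [Regs.init, mk]

/-! #### Moving a register onto another (reversing it) -/

/-- `move k k'`: pop every bit of register `k` and push it onto `k'`. [folklore] -/
def move (k k' : Rg) : Com Rg := loop k (push k' true) (push k' false)

/-- **Semantics of `move`**: register `k` is emptied and its reverse is pushed onto `k'`, at cost
`3|w| + 1`. [folklore] -/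
theorem runs_move {k k' : Rg} (hkk : k ≠ k') : ∀ (w : List Bool) (R : Regs Rg), R k = w →
    Runs (move k k') R (Function.update (Function.update R k []) k' (w.reverse ++ R k'))
      (3 * w.length + 1)
  | [], R, hR => by
    refine (Runs.loop_nil _ _ hR).congr ?_
    rw [List.reverse_nil, List.nil_append, ← hR, Function.update_eq_self, Function.update_eq_self]
  | b :: w, R, hR => by
    have hk' : k' ≠ k := fun h => hkk h.symm
    have hR₁k : (Function.update (Function.update R k w) k' (b :: (Function.update R k w) k')) k = w := by
      rw [Function.update_of_ne hkk.symm.symm]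
      · exact Function.update_self ..
    have ih := runs_move hkk w _ hR₁k
    have hfin : Function.update (Function.update
          (Function.update (Function.update R k w) k' (b :: (Function.update R k w) k')) k [])
          k' (w.reverse ++ (Function.update (Function.update R k w) k'
            (b :: (Function.update R k w) k')) k') =
        Function.update (Function.update R k []) k' ((b :: w).reverse ++ R k') := by
      rw [Function.update_self, Function.update_of_ne hk', List.reverse_cons, List.append_assoc,
        List.singleton_append, Function.update_comm hk', Function.update_idem, Function.update_idem]
    have hcost : 3 * (b :: w).length + 1 = 1 + 2 + (3 * w.length + 1) := by simp; ring
    rw [hcost]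
    cases b
    · exact Runs.loop_false' hR rfl (Runs.push k' false _) (ih.congr hfin)
    · exact Runs.loop_true' hR rfl (Runs.push k' true _) (ih.congr hfin)

/-! #### Parsing the pair -/

/-- Drain the rest of the input onto `v`. [folklore] -/
def drainV : Com Rg := move .inp .v

/-- Loop body after a first bit `1`: a second `1` is a bit of the first component; `10` is
malformed (ignored). [folklore] -/
def bodyPT : Com Rg := pop .inp (push .u true) skip skip

/-- Loop body after a first bit `0`: `01` is the separator (drain the second component), `00` is
a bit of the first component. [folklore] -/
def bodyPF : Com Rg := pop .inp drainV (push .u false) skip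

/-- The parser of `boolPair x y`: afterwards `u = reverse x`, `v = reverse y`. [folklore] -/
def parse : Com Rg := loop .inp bodyPT bodyPF

/-- Functional semantics of `parse` on registers `(inp, u, v)`. [folklore] -/
def parseSpec : List Bool → List Bool → List Bool → List Bool × List Bool
  | [], U, V => (U, V)
  | [_], U, V => (U, V)
  | true :: true :: z, U, V => parseSpec z (true :: U) V
  | true :: false :: z, U, V => parseSpec z U V
  | false :: false :: z, U, V => parseSpec z (false :: U) V
  | false :: true :: z, U, V => (U, z.reverse ++ V)

/-- **Semantics of `parse`** (cost `≤ 5|z| + 1`). [folklore] -/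
theorem runs_parse : ∀ (z U V d e f g h : List Bool),
    Runs parse (mk z U V d e f g h) (mk [] (parseSpec z U V).1 (parseSpec z U V).2 d e f g h)
      (5 * z.length + 1)
  | [], U, V, d, e, f, g, h => Runs.loop_nil _ _ rfl
  | [a], U, V, d, e, f, g, h => by
    have hrest : Runs parse (mk [] U V d e f g h) (mk [] U V d e f g h) 1 := Runs.loop_nil _ _ rfl
    refine Runs.mono ?_ (show (0 + 2) + 2 + 1 ≤ 5 * [a].length + 1 by simp)
    cases a
    · exact Runs.loop_false' (w := []) rfl (update_inp ..) (Runs.pop_nil _ _ rfl (Runs.skip _)) hrest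
    · exact Runs.loop_true' (w := []) rfl (update_inp ..) (Runs.pop_nil _ _ rfl (Runs.skip _)) hrest
  | true :: true :: z, U, V, d, e, f, g, h => by
    have ih := runs_parse z (true :: U) V d e f g h
    refine Runs.mono ?_ (show (1 + 2) + 2 + (5 * z.length + 1) ≤ 5 * (true :: true :: z).length + 1 by
      simp; omega)
    exact Runs.loop_true' rfl (update_inp ..)
      (Runs.pop_true' _ _ rfl (update_inp ..) (Runs.push' (update_u ..))) ih
  | true :: false :: z, U, V, d, e, f, g, h => by
    have ih := runs_parse z U V d e f g h
    refine Runs.mono ?_ (show (0 + 2) + 2 + (5 * z.length + 1) ≤ 5 * (true :: false :: z).length + 1 by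
      simp; omega)
    exact Runs.loop_true' rfl (update_inp ..)
      (Runs.pop_false' _ _ rfl (update_inp ..) (Runs.skip _)) ih
  | false :: false :: z, U, V, d, e, f, g, h => by
    have ih := runs_parse z (false :: U) V d e f g h
    refine Runs.mono ?_ (show (1 + 2) + 2 + (5 * z.length + 1) ≤ 5 * (false :: false :: z).length + 1 by
      simp; omega)
    exact Runs.loop_false' rfl (update_inp ..)
      (Runs.pop_false' _ _ rfl (update_inp ..) (Runs.push' (update_u ..))) ih
  | false :: true :: z, U, V, d, e, f, g, h => by
    -- separator: drain `z` onto `v`, then the loop exits on the empty input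
    have hdrain : Runs drainV (mk z U V d e f g h) (mk [] U (z.reverse ++ V) d e f g h) (3 * z.length + 1) := by
      have := runs_move (k := Rg.inp) (k' := Rg.v) (by decide) z (mk z U V d e f g h) rfl
      unfold drainV
      simpa using this
    have hrest : Runs parse (mk [] U (z.reverse ++ V) d e f g h) (mk [] U (z.reverse ++ V) d e f g h) 1 :=
      Runs.loop_nil _ _ rfl
    refine Runs.mono ?_ (show ((3 * z.length + 1) + 2) + 2 + 1 ≤ 5 * (false :: true :: z).length + 1 by
      simp; omega)
    exact Runs.loop_false' rfl (update_inp ..) (Runs.pop_true' _ _ rfl (update_inp ..) hdrain) hrest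

/-- `parse` on a pair: `u = reverse x ++ U`, `v = reverse y ++ V`. [folklore] -/
theorem parseSpec_boolPair : ∀ (x y U V : List Bool),
    parseSpec (boolPair x y) U V = (x.reverse ++ U, y.reverse ++ V)
  | [], y, U, V => by simp [boolPair, parseSpec]
  | b :: x, y, U, V => by
    have hcons : boolPair (b :: x) y = b :: b :: boolPair x y := by simp [boolPair]
    rw [hcons]
    cases b
    · rw [parseSpec, parseSpec_boolPair x y]; simp
    · rw [parseSpec, parseSpec_boolPair x y]; simp

/-- Size of the parsed components. [folklore] -/
theorem length_parseSpec_le : ∀ (z U V : List Bool),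
    (parseSpec z U V).1.length ≤ z.length + U.length ∧ (parseSpec z U V).2.length ≤ z.length + V.length
  | [], U, V => by simp [parseSpec]
  | [_], U, V => by simp [parseSpec]
  | true :: true :: z, U, V => by
    have := length_parseSpec_le z (true :: U) V; simp [parseSpec] at this ⊢; omega
  | true :: false :: z, U, V => by
    have := length_parseSpec_le z U V; simp [parseSpec] at this ⊢; omega
  | false :: false :: z, U, V => by
    have := length_parseSpec_le z (false :: U) V; simp [parseSpec] at this ⊢; omega
  | false :: true :: z, U, V => by simp [parseSpec]; omega

/-! #### The subtraction loop -/

/-- The borrow flag as a register content. [folklore] -/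
def flag (b : Bool) : List Bool := if b then [true] else []

/-- Emit the result bit `a - c - b` and set the borrow flag (which is empty at this point). [folklore] -/
def leaf (a c b : Bool) : Com Rg :=
  push .res (subBit a c b) ;; (if subBorrow a c b then push .br true else skip)

/-- Read the bit `c` of the second operand (`0` if exhausted) and emit. [folklore] -/
def withB (a b : Bool) : Com Rg := pop .v2 (leaf a true b) (leaf a false b) (leaf a false b)

/-- Loop body for the bit `a` of the first operand: read (and consume) the borrow flag. [folklore] -/
def bodyU (a : Bool) : Com Rg := pop .br (withB a true) skip (withB a false)

/-- The subtraction loop over the bits of the first operand. [folklore] -/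
def subLoop : Com Rg := loop .u2 (bodyU true) (bodyU false)

/-- Semantics of `leaf` (cost `≤ 2`). [folklore] -/
theorem runs_leaf (a c b : Bool) (zi zu zv zu2 zv2 zres zo : List Bool) :
    Runs (leaf a c b) (mk zi zu zv zu2 zv2 [] zres zo)
      (mk zi zu zv zu2 zv2 (flag (subBorrow a c b)) (subBit a c b :: zres) zo) 2 := by
  unfold leaf flag
  cases subBorrow a c b
  · simpa using (Runs.seq (Runs.push' (update_res zi zu zv zu2 zv2 [] zres zo (subBit a c b :: zres)))
      (Runs.skip _)).mono (show 1 + 0 ≤ 2 by norm_num)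
  · simpa using Runs.seq (Runs.push' (update_res zi zu zv zu2 zv2 [] zres zo (subBit a c b :: zres)))
      (Runs.push' (update_br zi zu zv zu2 zv2 [] (subBit a c b :: zres) zo [true]))

/-- Semantics of `withB` (cost `≤ 4`). [folklore] -/
theorem runs_withB (a b : Bool) (v zi zu zv zu2 zres zo : List Bool) :
    Runs (withB a b) (mk zi zu zv zu2 v [] zres zo)
      (mk zi zu zv zu2 v.tail (flag (subBorrow a (v.headD false) b))
        (subBit a (v.headD false) b :: zres) zo) 4 := by
  unfold withB
  rcases v with _ | ⟨c, v⟩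
  · exact Runs.pop_nil _ _ rfl (runs_leaf a false b ..)
  · cases c
    · exact Runs.pop_false' _ _ rfl (update_v2 ..) (runs_leaf a false b ..)
    · exact Runs.pop_true' _ _ rfl (update_v2 ..) (runs_leaf a true b ..)

/-- Semantics of `bodyU` (cost `≤ 6`). [folklore] -/
theorem runs_bodyU (a b : Bool) (v zi zu zv zu2 zres zo : List Bool) :
    Runs (bodyU a) (mk zi zu zv zu2 v (flag b) zres zo)
      (mk zi zu zv zu2 v.tail (flag (subBorrow a (v.headD false) b))
        (subBit a (v.headD false) b :: zres) zo) 6 := by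
  unfold bodyU
  cases b
  · exact Runs.pop_nil _ _ rfl (runs_withB a false v ..)
  · exact Runs.pop_true' _ _ rfl (update_br ..) (runs_withB a true v ..)

/-- Functional semantics of the subtraction loop on registers `(v2, br, res)`. [folklore] -/
def subSpec : List Bool → List Bool → Bool → List Bool → List Bool × Bool × List Bool
  | [], v, b, res => (v, b, res)
  | a :: u, v, b, res => subSpec u v.tail (subBorrow a (v.headD false) b) (subBit a (v.headD false) b :: res)

/-- **Semantics of `subLoop`** (cost `≤ 8|u| + 1`). [folklore] -/
theorem runs_subLoop : ∀ (u v : List Bool) (b : Bool) (res zi zu zv zo : List Bool),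
    Runs subLoop (mk zi zu zv u v (flag b) res zo)
      (mk zi zu zv [] (subSpec u v b res).1 (flag (subSpec u v b res).2.1) (subSpec u v b res).2.2 zo)
      (8 * u.length + 1)
  | [], v, b, res, zi, zu, zv, zo => Runs.loop_nil _ _ rfl
  | a :: u, v, b, res, zi, zu, zv, zo => by
    have ih := runs_subLoop u v.tail (subBorrow a (v.headD false) b) (subBit a (v.headD false) b :: res)
      zi zu zv zo
    have hcost : 8 * (a :: u).length + 1 = 6 + 2 + (8 * u.length + 1) := by simp; ring
    rw [hcost]
    cases a
    · exact Runs.loop_false' rfl (update_u2 ..) (runs_bodyU false b v ..) ih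
    · exact Runs.loop_true' rfl (update_u2 ..) (runs_bodyU true b v ..) ih

/-- The result register of the subtraction loop holds the reversed difference bits. [folklore] -/
theorem subSpec_res : ∀ (u v : List Bool) (b : Bool) (res : List Bool),
    (subSpec u v b res).2.2 = (subBits u v b).reverse ++ res
  | [], v, b, res => by simp [subSpec, subBits]
  | a :: u, v, b, res => by
    rw [subSpec, subSpec_res, subBits, List.reverse_cons, List.append_assoc, List.singleton_append]

/-! #### Emitting the canonical result -/

/-- Drain the remaining result bits onto the output. [folklore] -/
def drainOut : Com Rg := move .res .out

/-- Skip the leading zeros of the result; from the first `1` on, copy everything. [folklore] -/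
def outLoop : Com Rg := loop .res (push .out true ;; drainOut) skip

/-- Functional semantics of `outLoop` on registers `(res, out)`. [folklore] -/
def outSpec : List Bool → List Bool → List Bool
  | [], o => o
  | false :: r, o => outSpec r o
  | true :: r, o => r.reverse ++ (true :: o)

/-- **Semantics of `outLoop`** (cost `≤ 3|r| + 5`). [folklore] -/
theorem runs_outLoop : ∀ (r o zi zu zv zu2 zv2 zbr : List Bool),
    Runs outLoop (mk zi zu zv zu2 zv2 zbr r o) (mk zi zu zv zu2 zv2 zbr [] (outSpec r o)) (3 * r.length + 5)
  | [], o, zi, zu, zv, zu2, zv2, zbr => (Runs.loop_nil _ _ rfl).mono (by simp)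
  | false :: r, o, zi, zu, zv, zu2, zv2, zbr => by
    have ih := runs_outLoop r o zi zu zv zu2 zv2 zbr
    refine Runs.mono ?_ (show 0 + 2 + (3 * r.length + 5) ≤ 3 * (false :: r).length + 5 by simp; omega)
    exact Runs.loop_false' rfl (update_res ..) (Runs.skip _) ih
  | true :: r, o, zi, zu, zv, zu2, zv2, zbr => by
    have hdrain : Runs drainOut (mk zi zu zv zu2 zv2 zbr r (true :: o))
        (mk zi zu zv zu2 zv2 zbr [] (r.reverse ++ (true :: o))) (3 * r.length + 1) := by
      have := runs_move (k := Rg.res) (k' := Rg.out) (by decide) r (mk zi zu zv zu2 zv2 zbr r (true :: o)) rfl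
      unfold drainOut
      simpa using this
    have hrest : Runs outLoop (mk zi zu zv zu2 zv2 zbr [] (r.reverse ++ (true :: o)))
        (mk zi zu zv zu2 zv2 zbr [] (r.reverse ++ (true :: o))) 1 := Runs.loop_nil _ _ rfl
    refine Runs.mono ?_ (show (1 + (3 * r.length + 1)) + 2 + 1 ≤ 3 * (true :: r).length + 5 by simp; omega)
    exact Runs.loop_true' rfl (update_res ..) (Runs.seq (Runs.push' (update_out ..)) hdrain) hrest

/-- `outSpec` strips the leading zeros and reverses onto the output. [folklore] -/
theorem outSpec_eq : ∀ (r o : List Bool), outSpec r o = (dropFalses r).reverse ++ o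
  | [], o => rfl
  | false :: r, o => outSpec_eq r o
  | true :: r, o => by simp [outSpec, dropFalses]

/-! #### The whole program -/

/-- The subtraction program. [folklore] -/
def subProg : Com Rg := parse ;; move .u .u2 ;; move .v .v2 ;; subLoop ;; outLoop

end BinSub

open BinSub in
/-- **The function computed by the subtraction program** (its functional semantics on every
input). [folklore] -/
def subPairFn (z : List Bool) : List Bool :=
  BinSub.outSpec (BinSub.subSpec (BinSub.parseSpec z [] []).1.reverse (BinSub.parseSpec z [] []).2.reverse
    false []).2.2 []

open BinSub Com in
/-- **The subtraction program computes `subPairFn` in linear time** (`22|z| + 9` steps). [folklore] -/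
theorem runs_subProg (z : List Bool) :
    Runs subProg (Regs.init Rg.inp z)
      (mk [] [] [] [] (subSpec (parseSpec z [] []).1.reverse (parseSpec z [] []).2.reverse false []).1
        (flag (subSpec (parseSpec z [] []).1.reverse (parseSpec z [] []).2.reverse false []).2.1)
        [] (subPairFn z)) (22 * z.length + 9) := by
  rw [init_eq]
  set U := (parseSpec z [] []).1 with hU
  set V := (parseSpec z [] []).2 with hV
  obtain ⟨hUl, hVl⟩ := length_parseSpec_le z [] []
  rw [← hU, List.length_nil, add_zero] at hUl
  rw [← hV, List.length_nil, add_zero] at hVl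
  have h1 : Runs parse (mk z [] [] [] [] [] [] []) (mk [] U V [] [] [] [] []) (5 * z.length + 1) := by
    have := runs_parse z [] [] [] [] [] [] []
    rwa [← hU, ← hV] at this
  have h2 : Runs (move .u .u2) (mk [] U V [] [] [] [] []) (mk [] [] V U.reverse [] [] [] []) (3 * U.length + 1) := by
    have := runs_move (k := Rg.u) (k' := Rg.u2) (by decide) U (mk [] U V [] [] [] [] []) rfl
    simpa using this
  have h3 : Runs (move .v .v2) (mk [] [] V U.reverse [] [] [] []) (mk [] [] [] U.reverse V.reverse [] [] [])
      (3 * V.length + 1) := by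
    have := runs_move (k := Rg.v) (k' := Rg.v2) (by decide) V (mk [] [] V U.reverse [] [] [] []) rfl
    simpa using this
  have h4 := runs_subLoop U.reverse V.reverse false [] [] [] [] []
  rw [show flag false = [] from rfl] at h4
  set T := subSpec U.reverse V.reverse false [] with hT
  have hres : T.2.2.length = U.length := by
    rw [hT, subSpec_res]; simp
  have h5 := runs_outLoop T.2.2 [] [] [] [] [] T.1 (flag T.2.1)
  have h15 := Runs.seq h1 (Runs.seq h2 (Runs.seq h3 (Runs.seq h4 h5)))
  refine (h15.mono ?_).congr rfl
  rw [List.length_reverse, hres]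
  omega

/-- **Binary subtraction on pairs is polynomial time**: `subPairFn ∈ FP`. [cite: AroraBarak2009, §1.3] -/
theorem subPairFn_mem_FP : subPairFn ∈ FP :=
  Com.mem_FP BinSub.subProg BinSub.Rg.inp BinSub.Rg.out (22 * Polynomial.X + 9) subPairFn fun z =>
    ⟨_, Or.inl (by simpa using runs_subProg z), rfl⟩

/-- **`subPairFn ⟨x, y⟩` is the canonical numeral of `val x - val y`** (for `val y ≤ val x`). [folklore] -/
theorem subPairFn_boolPair (x y : List Bool) (h : bitsToNat y ≤ bitsToNat x) :
    subPairFn (boolPair x y) = encodeNat (bitsToNat x - bitsToNat y) := by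
  rw [subPairFn, BinSub.parseSpec_boolPair, ← stripMSB_subBits x y h]
  simp only [List.append_nil, List.reverse_reverse, BinSub.subSpec_res, BinSub.outSpec_eq, stripMSB_eq]

/-- **`subPairFn ⟨bin n, bin k⟩ = bin (n - k)`** for `k ≤ n`. [folklore] -/
theorem subPairFn_encodeNat {n k : ℕ} (h : k ≤ n) :
    subPairFn (boolPair (encodeNat n) (encodeNat k)) = encodeNat (n - k) := by
  rw [subPairFn_boolPair _ _ (by rwa [bitsToNat_encodeNat, bitsToNat_encodeNat]), bitsToNat_encodeNat,
    bitsToNat_encodeNat]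

/-! ### The reindexing `⟨bin n, bin k⟩ ↦ ⟨bin n, bin (n - k)⟩` -/

/-- The reindexing map: copy, subtract in the second copy, project the first. [folklore] -/
noncomputable def reindexFn : List Bool → List Bool :=
  mapFstFn (fun w => (boolUnpair w).1) ∘ mapSndFn subPairFn ∘ copyFn

/-- **The reindexing map is polynomial time.** [cite: AroraBarak2009, §1.3] -/
theorem reindexFn_mem_FP : reindexFn ∈ FP :=
  comp_mem_FP (mapFstFn_mem_FP boolUnpairFst_mem_FP) (comp_mem_FP (mapSndFn_mem_FP subPairFn_mem_FP)
    copyFn_mem_FP)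

/-- `reindexFn ⟨u, w⟩ = ⟨u, subPairFn ⟨u, w⟩⟩`. [folklore] -/
theorem reindexFn_boolPair (u w : List Bool) :
    reindexFn (boolPair u w) = boolPair u (subPairFn (boolPair u w)) := by
  simp [reindexFn, Function.comp_apply, copyFn_apply, mapSndFn_boolPair, mapFstFn_boolPair]

/-- **`reindexFn ⟨bin n, bin k⟩ = ⟨bin n, bin (n - k)⟩`** for `k ≤ n` (Bürgisser 2009, proof of
Thm. 1.1(2): the reindexing `k ↦ n - k` of the coefficients of `∏ (X - i)`). [cite: Burgisser2006, proof of Thm. 1.1(2)] -/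
theorem reindexFn_encodeNat {n k : ℕ} (h : k ≤ n) :
    reindexFn (boolPair (encodeNat n) (encodeNat k)) = boolPair (encodeNat n) (encodeNat (n - k)) := by
  rw [reindexFn_boolPair, subPairFn_encodeNat h]

end Literature.Computability.Complexity
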